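import Summits.HubbardSuperconductivity.HubbardSuperconductivity.Theses.CooperSharpness
import Summits.HubbardSuperconductivity.HubbardSuperconductivity.Theorems.DeformationLadderLadderThesisRigidityReduction

/-!
# Route `CooperSharpness` — support item `GrowthGlue` (stmt-HubbardSuperconductivity-12852)

ONE TELESCOPING (card P0 of `cooper-coordinate-sharpness`). From the Cooper-coordinate growth
law at `(U, δ, g₀, b, η, L₀)` with `g₀ < 0 < b` and slack `η_L → 0`: choose `L₁ ≥ L₀` with
`η_L < b|g₀|/2` for `L ≥ L₁`. For an even side `L ≥ L₁` and a normalised `(N_L, S^z = 0)`-sector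
ground state `ψ` of the PURE model `hubbardTorus 2 L 1 U = H_L(U,0)` (the coupling-`0` member of
the local pair-coupling family, `H − ((0:ℝ):ℂ) • K = H`), the law at `(g₂, g₃) = (g₀, 0)` produces
a ground state `ψ₂` at `g₀` with `κ̃(ψ₂) + b|g₀| ≤ κ̃(ψ) + η_L`, where
`κ̃(φ) = -1 / log (θ(φ)/64)` and `θ(φ) = L⁻⁴ re ⟨φ, pFᴴ pF φ⟩ ∈ [0, 32]`
(`re_expect_pairPenalty_nonneg`, `re_expect_pairPenalty_le`). Since `θ(ψ₂)/64 ∈ [0, 1]`,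
`log (θ(ψ₂)/64) ≤ 0` and `κ̃(ψ₂) ≥ 0` (also for Lean's junk values `log 0 = 0`, `-1/0 = 0`);
hence `κ̃(ψ) ≥ b|g₀|/2 =: c > 0`, which forces `log (θ(ψ)/64) ∈ [-1/c, 0)`, `θ(ψ) > 0` and
`θ(ψ) ≥ 64 · exp (-1/c) = 64 · exp (2/(b g₀))`.

Sources: H. Duminil-Copin, V. Tassion, Comm. Math. Phys. 343 (2016) 725 (the telescoping of a
mean-field lower bound); D. J. Scalapino, Phys. Rep. 250 (1995) 329, §2 (d-wave pair field).
No new definitions; pure real analysis over the tree's a-priori bounds.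
-/

-- the mandated namespace `Summit.<Summit>.<Problem>.Theorems` repeats `HubbardSuperconductivity`
-- (single-problem summit, D-0017), which the `dupNamespace` linter flags on every declaration
set_option linter.dupNamespace false

namespace Summit.HubbardSuperconductivity.HubbardSuperconductivity.Theorems.CooperSharpness

open Matrix Filter Topology Literature.MathematicalPhysics.QuantumLattice
  Literature.Probability.LatticeModels
open Summit.HubbardSuperconductivity.HubbardSuperconductivity.Theorems.DeformationLadder
  (re_expect_pairPenalty_nonneg re_expect_pairPenalty_le)

/-- The normalised Cooper coordinate `-1 / log (θ/64)` is non-negative whenever `0 ≤ θ ≤ 64`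
(including Lean's conventions `log 0 = 0`, `-1/0 = 0`). [folklore] -/
theorem cooperCoordinate_nonneg {θ : ℝ} (h0 : 0 ≤ θ) (h1 : θ ≤ 64) :
    0 ≤ -1 / Real.log (θ / 64) := by
  have hlog : Real.log (θ / 64) ≤ 0 :=
    Real.log_nonpos (by positivity) (by rw [div_le_one (by norm_num : (0:ℝ) < 64)]; exact h1)
  rw [neg_div]
  exact neg_nonneg.2 (one_div_nonpos.2 hlog)

/-- **Osgood inversion of the Cooper coordinate.** If `0 ≤ θ` and `c ≤ -1 / log (θ/64)` with
`0 < c`, then `64 · exp (-1/c) ≤ θ`. [folklore] -/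
theorem le_of_cooperCoordinate_ge {θ c : ℝ} (h0 : 0 ≤ θ) (hc : 0 < c)
    (h : c ≤ -1 / Real.log (θ / 64)) : 64 * Real.exp (-1 / c) ≤ θ := by
  have hypos : 0 < -1 / Real.log (θ / 64) := hc.trans_le h
  have hyneg : Real.log (θ / 64) < 0 := by
    rw [neg_div] at hypos
    exact one_div_neg.1 (neg_pos.1 hypos)
  have hθpos : 0 < θ / 64 := by
    rcases (div_nonneg h0 (by norm_num : (0:ℝ) ≤ 64)).eq_or_lt with h' | h'
    · exfalso
      rw [← h', Real.log_zero] at hyneg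
      exact lt_irrefl _ hyneg
    · exact h'
  have hny : 0 < -Real.log (θ / 64) := neg_pos.2 hyneg
  -- `c ≤ 1/(-y)` with `-y > 0` gives `-y ≤ 1/c`, i.e. `-1/c ≤ y`
  have h1 : c * (-Real.log (θ / 64)) ≤ 1 := by
    have h' : c ≤ 1 / (-Real.log (θ / 64)) := by
      rw [one_div_neg_eq_neg_one_div, ← neg_div]
      exact h
    rwa [le_div_iff₀ hny] at h'
  have h2 : -1 / c ≤ Real.log (θ / 64) := by
    rw [neg_div, neg_le, le_div_iff₀' hc]
    exact h1
  have h3 : Real.exp (-1 / c) ≤ θ / 64 := by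
    calc Real.exp (-1 / c) ≤ Real.exp (Real.log (θ / 64)) := Real.exp_le_exp.2 h2
      _ = θ / 64 := Real.exp_log hθpos
  rw [le_div_iff₀ (by norm_num : (0:ℝ) < 64)] at h3
  linarith

/-- **`GrowthGlue`** (stmt-HubbardSuperconductivity-12852): one telescoping of the
Cooper-coordinate growth law from `g₀ < 0` to the pure model at `g = 0` gives the uniform floor
`64 · exp (2/(b g₀)) ≤ θ_L(ψ)` for every normalised `(N_L, S^z = 0)`-sector ground state `ψ` of
`hubbardTorus 2 L 1 U` at every even `L ≥ L₁`, where `L₁ ≥ L₀` is chosen with `η_L < b|g₀|/2`.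
[cite: DuminilCopinTassionCMP2016, §1 (mean-field bound integrated in the parameter)] -/
theorem growthGlue_proof :
    Summit.HubbardSuperconductivity.HubbardSuperconductivity.Theses.CooperSharpness.GrowthGlue := by
  intro U δ g₀ b η L₀ hg₀ hb hη hK
  have hc : 0 < b * (-g₀) / 2 := by
    have : 0 < b * (-g₀) := mul_pos hb (neg_pos.2 hg₀)
    linarith
  obtain ⟨L₁, hL₁⟩ := eventually_atTop.1 (hη.eventually_lt_const hc)
  refine ⟨max L₀ L₁, ?_⟩
  intro L _ hL hE ψ hψ1 hψ
  have hL0 : (0 : ℝ) < (L : ℝ) := Nat.cast_pos.2 (Nat.pos_of_ne_zero (NeZero.ne L))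
  have hL4 : (0 : ℝ) < (L : ℝ) ^ 4 := by positivity
  -- the pure model is the coupling-`0` member of the family
  have hψ' : IsGroundStateInSector (hubbardTorus 2 L 1 U - ((0 : ℝ) : ℂ) •
      (∑ x : TorusSite 2 L, Matrix.conjTranspose (localPair dWaveFormFactor L x) *
        localPair dWaveFormFactor L x)) (2 * ⌊(1 - δ) * (L : ℝ) ^ 2 / 2⌋₊) 0 ψ := by
    rw [Complex.ofReal_zero, zero_smul, sub_zero]
    exact hψ
  obtain ⟨ψ₂, hψ₂1, -, hle⟩ :=
    hK L (le_of_max_le_left hL) hE g₀ 0 le_rfl hg₀.le le_rfl ψ hψ1 hψ'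
  -- `κ̃(ψ₂) ≥ 0` from `θ(ψ₂) ∈ [0, 32]`
  have hθ₂0 : 0 ≤ (expect (Matrix.conjTranspose (pairField dWaveFormFactor L) *
      pairField dWaveFormFactor L) ψ₂).re / (L : ℝ) ^ 4 :=
    div_nonneg (re_expect_pairPenalty_nonneg L ψ₂) hL4.le
  have hθ₂1 : (expect (Matrix.conjTranspose (pairField dWaveFormFactor L) *
      pairField dWaveFormFactor L) ψ₂).re / (L : ℝ) ^ 4 ≤ 64 := by
    rw [div_le_iff₀ hL4]
    have := re_expect_pairPenalty_le L hψ₂1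
    linarith
  have hκ₂ := cooperCoordinate_nonneg hθ₂0 hθ₂1
  have hηL : η L < b * (-g₀) / 2 := hL₁ L (le_of_max_le_right hL)
  -- hence `κ̃(ψ) ≥ b|g₀|/2`
  have hge : b * (-g₀) / 2 ≤ -1 / Real.log ((expect (Matrix.conjTranspose
      (pairField dWaveFormFactor L) * pairField dWaveFormFactor L) ψ).re / (L : ℝ) ^ 4 / 64) := by
    linarith
  have hθ0 : 0 ≤ (expect (Matrix.conjTranspose (pairField dWaveFormFactor L) *
      pairField dWaveFormFactor L) ψ).re / (L : ℝ) ^ 4 :=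
    div_nonneg (re_expect_pairPenalty_nonneg L ψ) hL4.le
  have key := le_of_cooperCoordinate_ge hθ0 hc hge
  have hexp : -1 / (b * (-g₀) / 2) = 2 / (b * g₀) := by
    field_simp
  rwa [hexp] at key

end Summit.HubbardSuperconductivity.HubbardSuperconductivity.Theorems.CooperSharpness
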